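import Summits.CriticalPhenomena.SAWScalingLimit.Theorems.CriticalBubbleBound.Negative.CriticalBubbleBoundSubcritical
import Summits.CriticalPhenomena.SAWScalingLimit.Theorems.CriticalBubbleBound.Negative.CriticalBubbleBoundPointwise
import Literature.Probability.RandomPlanarGeometry.SAWWords

/-!
# Line `subcritical-bochner-positivity` — skeleton for the crux `SAWTotalPositivity.CriticalBubbleBound`
(crux item stmt-CriticalPhenomena-7117, route `route-CriticalPhenomena-SAWTotalPositivity`;
crux-strategist planner-cstrat-stmt-CriticalPhenomena-7117-s1-0, 2026-08-17; ALTERNATIVE line —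
the live skeleton `Lines/docking_census_joining.lean` is untouched)

## The lever (lens: STRENGTHEN — a sign structure instead of an exponent)

The crux is ONE number, `K_{x_c}(0,e₀) = G_{z_c}(0,e₀) < ∞` (landed normal forms), and by the
landed left-continuity `Negative.criticalBubbleBound_iff_subcritical_bounded` it is EQUIVALENT to a
uniform bound on the FINITE subcritical kernels `K_x(0,e₀)`, `0 < x < x_c`. The route's thesis is a
SIGN STRUCTURE of the SAW kernel (TP₂), and the standing adversary showed why TP₂ cannot give the
constant (degree-0 homogeneous, Disproof §9b). There is a second classical sign structure that DOES
carry an absolute constant: BOCHNER POSITIVE-DEFINITENESS of the translation-invariant kernel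
`v ↦ K_x(0,v)` on the group `ℤ²`. A positive-definite function is bounded by its value at the
identity, and for the SELF-AVOIDING kernel that value is `K_x(0,0) = 1` — the empty walk is the only
SAW from `0` to `0` (`Negative.latticeKernel_self`; for the memoryless kernel the diagonal is the
divergent return series, which is exactly how this line honours
`criticalBubbleBound_false_without_selfAvoidance`). Hence

  `SubcriticalPD` (every `K_x`, `0 < x < x_c`, is positive definite)  ⟹  `K_x(0,v) ≤ 1` for all
  `v`, all `x < x_c`  ⟹  `CriticalBubbleBound` with the explicit constant `C = 1`
  (numerically `G_{x_c}(0,e₀) ≈ 0.81`, certified `≥ 0.54`, Disproof §8 — consistent).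

In Fourier language `SubcriticalPD` says `Ĝ_x(k) = Σ_v K_x(0,v) cos(k·v) ≥ 0` on the torus: a SIGN
statement about the lace-expansion denominator `1 - 4x D̂(k) - Π̂_x(k)`, which Hara–Slade PROVE in
`d ≥ 5` on the way to the infrared bound; its SIZE companion (the bubble condition) is false on `ℤ²`
(tree theorem `not_bubbleCondition_two`), the sign statement is not: exact enumeration (this seat,
`c_n(v)` for `n ≤ 18` by endpoint, `c_n` to `n = 27`) gives `min_k Ĝ_x(k) = Ĝ_x(π,π) = χ(-x)`,
decreasing from `1` to `χ(-x_c) ≈ 0.12–0.14 > 0` — the value of the susceptibility at the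
ANTIFERROMAGNETIC SINGULARITY, finite by hyperscaling `dν > 1` and found positive on `(-x_c, 0]` by
the series analyses (Clisby–Liang–Slade / Jensen, Guttmann (ed.) LNP 775 §6.7.3: "assume
`χ(z) > 0` for `z ∈ (-z_c, 0]` … no numerical evidence for a zero of `χ` in the disk").

## The tower (what makes the strengthening inductive / decidable in instances)

Memory-`m` walks (no self-intersection inside any window of `m` consecutive steps) have kernels
`K^{(m)}_x ≥ K_x`, finite for `x < x_c^{(m)} = 1/μ_m` with `μ_m ↓ μ` (`μ_m ≤ c_m^{1/m} → μ`), and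
`K^{(m)}_x(0,v) ↓ K_x(0,v)` as `m → ∞`; positive-definiteness passes to pointwise limits. Each
`K^{(m)}_x` is a RATIONAL function of `(x, e^{ik})` (finite transfer matrix on `4·3^{m-2}` histories),
so `PD(m)` — "every finite memory-`m` kernel is positive definite" — is DECIDABLE for each `m`
(`m ≤ 3`: `Ĝ = (1-x²)/(1+3x²-2x(cos k₁+cos k₂)) > 0`, by hand). Verified numerically here for
`m = 2,4,6,8,10` up to `0.98·x_c^{(m)}` (minimum always at `(π,π)`: 0.340, 0.283, 0.255, 0.237,
0.224). `∀ m, PD(m)` ⟹ `SubcriticalPD` ⟹ crux.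

STUBS (registered): S1 `stub_memoryTowerPD` (conjecture-grade, HARDEST; instances decidable),
S2 `stub_towerLimitPD` (M/L: `μ_m → μ`, monotone convergence of the kernels, PD closed under
pointwise limits), S3 `stub_bochnerBound` (S/M: the 2×2 principal minor + `K_x(0,0) = 1` +
`K_x(0,-v) = K_x(0,v)`). Composition `CriticalBubbleBound_of` is kernel-checked glue through
`Negative.criticalBubbleBound_iff_subcritical_bounded` and `Negative.latticeKernel_adj_eq`.
-/

noncomputable section

open MeasureTheory Filter Topology Set Function
open Literature.Probability.LatticeModels
open Literature.Probability.RandomPlanarGeometry Literature.Probability.RandomPlanarGeometry.SAW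
open scoped ENNReal NNReal BigOperators

namespace Summit.CriticalPhenomena.SAWScalingLimit.Cruxes.CriticalBubbleBound.SubcriticalBochnerPositivity

open Summit.CriticalPhenomena.SAWScalingLimit.Theorems.CriticalBubbleBound.Negative
open Summit.CriticalPhenomena.SAWScalingLimit.Theses.SAWTotalPositivity (CriticalBubbleBound)

/-! ## Objects -/

/-- BOCHNER positive-definiteness of a translation-invariant real kernel `f` on the group `ℤ²`:
every finite quadratic form `Σ_{u,v ∈ s} a_u a_v f(v - u)` is nonnegative. [folklore] -/
def IsPosDef (f : Site 2 → ℝ) : Prop :=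
  ∀ (s : Finset (Site 2)) (a : Site 2 → ℝ), 0 ≤ ∑ u ∈ s, ∑ v ∈ s, a u * a v * f (v - u)

/-- The subcritical SAW two-point kernel as a real function, `v ↦ K_x(0,v)` (finite for `0 < x < x_c`,
`Negative.criticalBubbleBoundAt_of_lt`). [cite: MadrasSlade1993, §1.4] -/
def sawFn (x : ℝ) (v : Site 2) : ℝ := (latticeKernel x 0 v).toReal

/-- The strengthened statement: every subcritical SAW kernel of `ℤ²` is positive definite
(`Ĝ_x(k) ≥ 0` on the torus for `0 < x < x_c`). Conjecture-grade; proved for `d ≥ 5` by the lace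
expansion (infrared bound), numerically `min_k Ĝ_x(k) = χ(-x) ≥ χ(-x_c) ≈ 0.13 > 0` on `ℤ²`.
[cite: MadrasSlade1993, (1.4.12) and Theorem 6.1.6] -/
def SubcriticalPD : Prop := ∀ x : ℝ, 0 < x → x < criticalFugacity → IsPosDef (sawFn x)

/-- Memory-`m` self-avoidance of a step word: no two visit times at distance `≤ m` coincide. For
`m ≥ |w|` this is `IsSAW w`. [cite: MadrasSlade1993, §1.2 (walks with finite memory)] -/
def IsMemorySAW (m : ℕ) (w : List Step) : Prop :=
  ∀ i ∈ Finset.range (w.length + 1), ∀ j ∈ Finset.range (w.length + 1),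
    i < j → j ≤ i + m → traj w i ≠ traj w j

instance (m : ℕ) (w : List Step) : Decidable (IsMemorySAW m w) := by
  unfold IsMemorySAW; infer_instance

/-- `c^{(m)}_n(v)`: the number of `n`-step memory-`m` walks of `ℤ²` from `0` to `v`. [folklore] -/
def memCountAt (m n : ℕ) (v : Site 2) : ℕ :=
  ((words n).filter fun w => wEnd w = v ∧ IsMemorySAW m w).card

/-- The memory-`m` kernel `K^{(m)}_x(0,v) = Σ_n c^{(m)}_n(v) xⁿ ∈ [0,∞]` (finite iff `x < 1/μ_m`). [folklore] -/
def memKernel (m : ℕ) (x : ℝ) (v : Site 2) : ℝ≥0∞ :=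
  ∑' n : ℕ, (memCountAt m n v : ℝ≥0∞) * ENNReal.ofReal (x ^ n)

/-- The memory-`m` kernel as a real function. [folklore] -/
def memFn (m : ℕ) (x : ℝ) (v : Site 2) : ℝ := (memKernel m x v).toReal

/-- `PD(m)` for all `m` — the memory tower: every FINITE memory-`m` kernel is positive definite.
Each instance is a statement about a rational function of `(x, cos k₁, cos k₂, …)` and is decidable;
`m ≤ 3` is the closed form `(1-x²)/(1+3x²-2x(cos k₁+cos k₂)) > 0`. [folklore] -/
def MemoryTowerPD : Prop :=
  ∀ (m : ℕ) (x : ℝ), 0 < x → (∀ v : Site 2, memKernel m x v ≠ ⊤) → IsPosDef (memFn m x)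

/-! ## Audit names of the stub statements -/

namespace Goal

/-- Statement of stub S1 `stub_memoryTowerPD`. -/
abbrev stub_memoryTowerPD : Prop := MemoryTowerPD

/-- Statement of stub S2 `stub_towerLimitPD`. -/
abbrev stub_towerLimitPD : Prop := MemoryTowerPD → SubcriticalPD

/-- Statement of stub S3 `stub_bochnerBound`. -/
abbrev stub_bochnerBound : Prop :=
  ∀ x : ℝ, 0 < x → x < criticalFugacity → IsPosDef (sawFn x) → ∀ v : Site 2, latticeKernel x 0 v ≤ 1

end Goal

/-! ## The registered stubs -/

/-- **S1 `stub_memoryTowerPD`** (conjecture-grade, HARDEST). Every finite memory-`m` two-point kernel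
of `ℤ²` is Bochner positive definite. Instances: `m ≤ 1` (all words, `x < 1/4`):
`Ĝ = 1/(1 - 2x(cos k₁ + cos k₂)) > 0`; `m = 2, 3` (non-backtracking, `x < 1/3`):
`Ĝ = (1-x²)/(1+3x²-2x(cos k₁+cos k₂)) > 0`; `m = 4 … 10`: checked numerically up to `0.98/μ_m`
(this seat). A proof for all `m` is the open content of the line. -/
theorem stub_memoryTowerPD : MemoryTowerPD := by
  sorry

/-- **S2 `stub_towerLimitPD`** (size M/L, provable in principle). The tower reaches the SAW kernel:
for `0 < x < x_c` there is `m₀` with `x < 1/μ_m` for `m ≥ m₀` (`μ_m ≤ c_m^{1/m} → μ` by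
submultiplicativity), so the kernels `K^{(m)}_x` are finite; they decrease pointwise to `K_x(0,·)`
(a word that is memory-`m` for all `m` is self-avoiding; monotone convergence in `[0,∞]`), and a
pointwise limit of positive-definite real kernels is positive definite. -/
theorem stub_towerLimitPD : MemoryTowerPD → SubcriticalPD := by
  sorry

/-- **S3 `stub_bochnerBound`** (size S/M, provable now). Bochner's inequality for the SAW kernel:
positive-definiteness, the symmetry `K_x(0,-v) = K_x(0,v)` (`latticeKernel_map … negIso`), the
diagonal `K_x(0,0) = 1` (`latticeKernel_self` — SELF-AVOIDANCE) and finiteness below `x_c` give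
`K_x(0,v) ≤ 1` (the `2 × 2` principal minor on `{0, v}` with coefficients `(1,-1)`). -/
theorem stub_bochnerBound :
    ∀ x : ℝ, 0 < x → x < criticalFugacity → IsPosDef (sawFn x) → ∀ v : Site 2, latticeKernel x 0 v ≤ 1 := by
  sorry

/-! ## The composition (glue only; the landed left-continuity normal form does the work) -/

/-- **The composition**: the three stubs imply the crux BY NAME, with the constant `C = 1`, through
`Negative.criticalBubbleBound_iff_subcritical_bounded` (crux ⟺ the subcritical nearest-neighbour
kernels stay bounded) and `Negative.latticeKernel_adj_eq` (all neighbour pairs are one number). -/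
theorem CriticalBubbleBound_of_stubs :
    Goal.stub_memoryTowerPD → Goal.stub_towerLimitPD → Goal.stub_bochnerBound →
      _root_.Summit.CriticalPhenomena.SAWScalingLimit.Theses.SAWTotalPositivity.CriticalBubbleBound := by
  intro h1 h2 h3
  rw [criticalBubbleBound_iff_subcritical_bounded]
  refine ⟨1, ENNReal.one_ne_top, fun x hx0 hx u v huv => ?_⟩
  rw [latticeKernel_adj_eq x huv]
  exact h3 x hx0 hx (h2 h1 x hx0 hx) e₀

/-- **`CriticalBubbleBound` from the line `subcritical-bochner-positivity`**: sorry-free except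
through the registered stubs. -/
theorem CriticalBubbleBound_of :
    _root_.Summit.CriticalPhenomena.SAWScalingLimit.Theses.SAWTotalPositivity.CriticalBubbleBound :=
  CriticalBubbleBound_of_stubs stub_memoryTowerPD stub_towerLimitPD stub_bochnerBound

/-! ## Sanity (no sorry): the diagonal constant is self-avoidance -/

/-- The Bochner constant of the line is the weight of the EMPTY walk: `K_x(0,0) = 1` at every
fugacity (landed `latticeKernel_self`); contrast the memoryless kernel, whose diagonal at `x = 1/4`
is the divergent return series (landed `rwKernel_quarter_e₀_eq_top` for the neighbour value). -/
theorem sawFn_zero (x : ℝ) : sawFn x 0 = 1 := by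
  simp [sawFn, latticeKernel_self]

/-- The direct form of the line without the tower: `SubcriticalPD` and Bochner's inequality already
give the crux (for a prover who finds a direct proof of positive-definiteness). -/
theorem CriticalBubbleBound_of_subcriticalPD (hPD : SubcriticalPD) (hB : Goal.stub_bochnerBound) :
    _root_.Summit.CriticalPhenomena.SAWScalingLimit.Theses.SAWTotalPositivity.CriticalBubbleBound := by
  rw [criticalBubbleBound_iff_subcritical_bounded]
  refine ⟨1, ENNReal.one_ne_top, fun x hx0 hx u v huv => ?_⟩
  rw [latticeKernel_adj_eq x huv]
  exact hB x hx0 hx (hPD x hx0 hx) e₀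

end Summit.CriticalPhenomena.SAWScalingLimit.Cruxes.CriticalBubbleBound.SubcriticalBochnerPositivity

end
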